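import Summits.QuantumFields.BalabanUV.Beta.RowD1JointEndSymReflTablesAn1S2MWVB
import Summits.QuantumFields.BalabanUV.Beta.SymSecondOrderRemainderAn1

/-!
# `BalabanUV.Beta.RowD1JointEndSymReflTablesAn1S2R` — binder row D1: **THE LITERAL ROOT AT an1's CLOSED (0.4) TABLE RECORD, ALL TABLE LETTERS DISCHARGED —
# WHAT REMAINS OF hW ∧ hR IS THE CONTACT TABLE `X2s`, THREE LOCALISATIONS AND THE ONE SCALAR IDENTITY `hcomp`** — ROOT J `RowD1JointEndSymReflTablesAn1S2MWVB`
# (this gen, p299091) with the second-order remainder tables INSTANTIATED by the recursion the letters prescribe, `R2 := symR2An1 Lc N cΛ γ X2s`,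
# `Δ := symΔAn1 Lc N cΛ γ X2s` (`SymSecondOrderRemainderAn1`), and the bookkeeping letters `h0 hsplit hR2succ` SUPPLIED (`h0_sym` = involution + `ε² = 1`,
# `hsplit_sym` = `add_sub_cancel`, `hR2succ_sym` = `rfl`) — five binders fewer (`R2 h0 Δ hsplit hR2succ`)
# (β sub-cell, BINDER-OWNERS row D1 OWNER `b2b-balaban-beta-an2` gen 32, brick (N11b) «ROOT K»)

HONEST FRAMING (cell contract, verbatim): «discharging `BetaPertH` makes Bałaban's UV stability UNCONDITIONAL — a real constructive-QFT result; it is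
NOT the continuum limit and NOT the Clay problem.»  HONEST DEPENDENCY: continuum YM on T⁴ ⇐ BetaPertH ∧ nine spine estimates (0/9 proved);
BetaPertH ⇐ (D1) ∧ (D4) ∧ CAP+tail; G-an2-4 gates asym, D1 and NE2/3/4.
DERIVED cell leaf ([folklore] wiring BY NAME).  No statement of Bałaban's papers, no `[cite:]`, no `Prop` fact, no `def`.  EVERY hypothesis below is a displayed
BINDER.  WHAT REMAINS DISPLAYED: `2 ≤ N`; the two unit locks `hΛ` ∕ `hcB`; the first-order contact coefficient `γ` (`hγ`); the second-order contact table `X2s`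
(FREE — X-an2-60's choice; `hX2L` its localisation); the localisation `hDg` of the dressed first-order response word and `hΔL` of the DEFINED split defect
`symΔAn1 …`; and **`hcomp` — the cancellation of the chart-(II) defect against the W-remainder `Rm_j = ½•conjV 𝕄_j (diagK (X2sᵀ − X2s)) + ½•(Δ_j + Δ_jᵀ)`, the (N8)
identity, now a statement about OUR explicit kernels only**; then D1Tel, D1Rep, the printed B5 facts, the window.  hW = NOTHING; hR table letters = NOTHING.
OWNER's word on the row: of the five root-level classes, hW is EMPTY and hR is REDUCED TO `hcomp` + three localisations (the referee's census word is theirs);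
`hcomp` is NOT claimed — it is the content of the second-order hR class and is displayed.  HONEST: composition by name; NOT D1, NOT `BetaPertH`, NOT
continuum, NOT Clay.
Provenance: β sub-cell, unit beta-an2 gen 32 (row OWNER), 2026-08-21 (v1); over `RowD1JointEndSymReflTablesAn1S2MWVB` and `SymSecondOrderRemainderAn1` (both
this gen) BY NAME; no existing file touched.
-/

noncomputable section

open Finset
open scoped BigOperators
open Literature.Probability.LatticeModels (Torus.proj)
open Literature.MathematicalPhysics.QuantumFieldTheory
open Literature.MathematicalPhysics.QuantumFieldTheory.Balaban1983to89
open Literature.MathematicalPhysics.QuantumFieldTheory.Balaban1983to89.Beta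
open Literature.MathematicalPhysics.QuantumFieldTheory.Balaban1983to89.Beta.VectorTailsLoc (fam kfam)
open Literature.MathematicalPhysics.QuantumFieldTheory.Balaban1983to89.Beta.VectorLegVolumeAdapter (MvE)
open ExpKernelCalculus (MKer BiLoc VertexFamily comp tr tadpole shiftK)
open PolarizationSign (reflSign WardTransversal AxisReflectionCovariant)
open KernelReflection (refK)
open ResolventReflection (bref Φ)
open AffineAveraging (box toSite)
open AveragingContoursRooted (ctr ctrOff ctrOff_mem_box)
open OneStepResolventKernel (Fib LocStencil JetData)
open OneStepKernelFamily (KInvStep colH vertexOfK TbalOf flipK D1Tel D1Rep D1Drift)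
open KernelWard (divV divW)
open StepJetData (mfNeg wilsonA)
open BalabanStepJetsSucc (mmRead wE wVH)
open SecondOrderResponse (dM W2OfK LocStencilFM)
open BalabanCompositeJets (LocStencil₂)
open BalabanStepW2 (M2Of wB2 wV4)
open WilsonBiStencil (wilsonW₂)
open WilsonVertex2Sym (wsym22)
open Summit.QuantumFields.BalabanUV.Beta.TameKernelCalculus
open Summit.QuantumFields.BalabanUV.Beta.ChartConjugation (conjV conjW)
open Summit.QuantumFields.BalabanUV.Beta.ChartConjugationDefectEnd (conjDefect sandwichDefect)
open Summit.QuantumFields.BalabanUV.Beta.AxialDressingRooted (one_le_of_neZero)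
open Summit.QuantumFields.BalabanUV.Beta.SymmetrisedDressingKernel (coDressKSymAt)
open Summit.QuantumFields.BalabanUV.Beta.AveragingWardRootedStencils (legInd)
open Summit.QuantumFields.BalabanUV.Beta.SymmetrisedStepJets (SymTables Gsym SsymOf SpureSymOf JsB12Sym0 JsB12Sym)
open Summit.QuantumFields.BalabanUV.Beta.SpineRooted (M1Of SpureRecOf T2RecOf WrecOf)
open Summit.QuantumFields.BalabanUV.Beta.WardLocusRecursive (SrecOf)
open Summit.QuantumFields.BalabanUV.Beta.WardLocusCubic (mmSym)
open Summit.QuantumFields.BalabanUV.Beta.SymShiftedSpread (bhKStepSh)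
open Summit.QuantumFields.BalabanUV.Beta.BorderedHessian (sgnK bhK stepScale diagK)
open Summit.QuantumFields.BalabanUV.Beta.E3ContactGenerator (ctGenM)
open Summit.QuantumFields.BalabanUV.Beta.DshAn1 (Dsh)
open Summit.QuantumFields.BalabanUV.Beta.SymAveragingHessianCounts (symVhSAt symHessFFAt)
open Summit.QuantumFields.BalabanUV.Beta.SymAveragingMixedJetTables (symMixFFAt)
open Summit.QuantumFields.BalabanUV.Beta.SymSecondOrderTablesAn1 (symVh₂SAn1 symTablesAn1S2 locStencil₂_symVh₂SAn1 symVh₂SAn1_hBt symVh₂SAn1_inl_inl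
  symMixFFAt_hmix_ctr symMixFFAt_hmixt)
open Summit.QuantumFields.BalabanUV.Beta.RowD1JointEndSymReflTablesAn1S2 (d1Drift_JsB12Sym_an1TablesS2_of_bordMixLetters_reflTableLetters_D1Tel_D1Rep)
open Summit.QuantumFields.BalabanUV.Beta.SymMixedReflectionLetterAn1 (symRMrAn1 hM2_symMixFFAt)

open Summit.QuantumFields.BalabanUV.Beta.RowD1JointEndSymReflTablesAn1S2MWVB (d1Drift_JsB12Sym_an1TablesS2_of_level0ReflLetter_split_D1Tel_D1Rep_of_locks)
open Summit.QuantumFields.BalabanUV.Beta.SymSecondOrderRemainderAn1 (symR2An1 symΔAn1 h0_sym hsplit_sym hR2succ_sym)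

namespace Summit.QuantumFields.BalabanUV.Beta.RowD1JointEndSymReflTablesAn1S2R

variable {Lc : ℕ} [NeZero Lc]

/-- **ROW D1 — THE LITERAL ROOT AT an1's CLOSED TABLE RECORD `symTablesAn1S2 3 Lc cΛ`, ALL TABLE LETTERS DISCHARGED: `D1Drift ⟸ locks ∧ hγ ∧ (X2s, hX2L) ∧ hDg ∧
hΔL ∧ hcomp ∧ D1Tel ∧ D1Rep` (+ the route theorem's own binders)** — ROOT J with `R2 := symR2An1 …`, `Δ := symΔAn1 …`, `h0 := h0_sym`, `hsplit := hsplit_sym`,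
`hR2succ := hR2succ_sym` (`SymSecondOrderRemainderAn1`); five binders fewer.  HONEST: composition by name; `hcomp` displayed, NOT claimed; NOT D1. -/
theorem d1Drift_JsB12Sym_an1TablesS2_of_locks_contact_loc_hcomp_D1Tel_D1Rep (hLc : Odd Lc) (hL2 : 2 ≤ Lc) {N : ℕ} (hN : 2 ≤ N) (cΛ cB : ℝ)
    -- the two unit locks of an1's TABLE-FIT tier 2 (Λ-lock of `SymMixedWardSiteLaw.symBondWardM`, B-lock of `SymBorderWardSiteLaw.symBondWardB`)
    (hΛ : cΛ * (Lc : ℝ) ^ 4 = 2) (hcB : cB = -((Lc : ℝ) ^ 12 / 4))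
    -- the first-order contact coefficient, displayed
    (γ : ℕ → ℝ) (hγ : ∀ j, γ j = -((Lc : ℝ) ^ 8 / 2) * wVH 3 Lc j / (stepScale 3 Lc j * (Lc : ℝ) ^ 4))
    -- hR, SECOND ORDER: the contact table `X2s` (free) and the three localisations; the table letters are ALL discharged (ROOT H∕I∕J + `SymSecondOrderRemainderAn1`)
    (X2s : ℕ → Fin 4 → Fin 4 → (Fin 4 → ℤ) → Fin 4 → (Fin 4 → ℤ) → (Fin 4 → ℤ) → Fib 3 → ℝ)
    (hDg : ∀ (j : ℕ) (α ν : Fin 4) (y' : Fin 4 → ℤ),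
      Loc (dM (Gsym (d := 3) Lc j) Lc (fun κ u => SpureRecOf 3 Lc (symVhSAt (ctr 4 Lc) 3 Lc rfl) (symHessFFAt (ctr 4 Lc) Lc) (Gsym Lc) ((Lc : ℝ) ^ 4) (-((Lc : ℝ) ^ 8 / 2)) cΛ j κ u + conjV (bhKStepSh 3 Lc (Dsh Lc) j) (diagK fun p c => γ j * ctGenM 3 (bhK Lc + Dsh Lc) α Lc κ u p c)) (M1Of 3 Lc (symHessFFAt (ctr 4 Lc) Lc) cΛ j) ν y'))
    (hX2L : ∀ j α μ y ν y', Loc (diagK (X2s j α μ y ν y'))) (hΔL : ∀ j α μ y ν y', Loc (symΔAn1 Lc N cΛ γ X2s j α μ y ν y'))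
    -- the cancellation of the chart-(II) defect against the W-REMAINDER `Rm_j` (the compensator is now IDENTIFIED: `Wc := Rm`, `X₂ := diagK X2s`) — the (N8) object
    (hcomp : ∀ (j : ℕ) (α μ : Fin 4) (y : Fin 4 → ℤ) (ν : Fin 4) (y' : Fin 4 → ℤ),
      (1 / 2 : ℝ) * tadpole (coDressKSymAt (toSite (ctrOff 4 Lc)) Lc (KInvStep (d := 3) Lc j))
        ((1 / 2 : ℝ) • conjV (bhKStepSh 3 Lc (Dsh Lc) j) (diagK fun p a => X2s j α ν y' μ y p a - X2s j α μ y ν y' p a) +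
          (1 / 2 : ℝ) • (symΔAn1 Lc N cΛ γ X2s j α μ y ν y' + symΔAn1 Lc N cΛ γ X2s j α ν y' μ y))
        + conjDefect (coDressKSymAt (toSite (ctrOff 4 Lc)) Lc (KInvStep (d := 3) Lc j)) (bhKStepSh 3 Lc (Dsh Lc) j)
            (vertexOfK (coDressKSymAt (toSite (ctrOff 4 Lc)) Lc (KInvStep (d := 3) Lc j)) Lc (JsB12Sym0 hLc N (symTablesAn1S2 3 Lc cΛ) cΛ (-((Lc : ℝ) ^ 12 / 4)) j).S μ y)
            (vertexOfK (coDressKSymAt (toSite (ctrOff 4 Lc)) Lc (KInvStep (d := 3) Lc j)) Lc (JsB12Sym0 hLc N (symTablesAn1S2 3 Lc cΛ) cΛ (-((Lc : ℝ) ^ 12 / 4)) j).S ν y')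
            (vertexOfK (coDressKSymAt (toSite (ctrOff 4 Lc)) Lc (KInvStep (d := 3) Lc j)) Lc (fun κ u => γ j • diagK (ctGenM 3 (bhK Lc + Dsh Lc) α Lc κ u)) μ y)
            (vertexOfK (coDressKSymAt (toSite (ctrOff 4 Lc)) Lc (KInvStep (d := 3) Lc j)) Lc (fun κ u => γ j • diagK (ctGenM 3 (bhK Lc + Dsh Lc) α Lc κ u)) ν y')
            (diagK (X2s j α μ y ν y')) = 0)
    -- the route theorem's own binders, verbatim
    (a : ℝ) (ha : 0 < a)
    (h12 : B5.Prop12Printed (fam (fun i : ℕ+ × ℕ => ((i.1 : ℕ+) : ℕ)) (fun i => i.1.pos) MvE a ha))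
    (h126 : B5.Kernel126_127Printed (kfam (fun i : ℕ+ × ℕ => ((i.1 : ℕ+) : ℕ)) MvE))
    {L : Type*} {SL : Finset L} (hSL : SL.Nonempty) (k : L → Fin 4) {μ ν : Fin 4} (hμν : μ ≠ ν) {Nc : ℝ} (hNc : Nc ≠ 0)
    (Jc : ∀ m : ℕ, JetData 3 (Lc ^ m))
    (htel : D1Tel Lc (JsB12Sym hLc N (symTablesAn1S2 3 Lc cΛ) cΛ cB) Jc)
    {cc : ℝ} {Mw' : ℕ → ℕ} (hc : 1 ≤ cc) (hMwin : ∀ L : ℕ, 2 ≤ L → 1 ≤ Mw' L ∧ (L : ℝ) ≤ cc * Mw' L) (hML : ∀ L : ℕ, 2 ≤ L → Mw' L ≤ L)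
    (hrep : D1Rep Lc Jc Nc μ ν a SL k) :
    D1Drift Lc (JsB12Sym hLc N (symTablesAn1S2 3 Lc cΛ) cΛ cB) Nc μ ν := by
  subst hcB
  exact d1Drift_JsB12Sym_an1TablesS2_of_level0ReflLetter_split_D1Tel_D1Rep_of_locks hLc hL2 hN cΛ (-((Lc : ℝ) ^ 12 / 4)) hΛ rfl γ hγ
    (symR2An1 Lc N cΛ γ X2s) (h0_sym N cΛ γ X2s) X2s (symΔAn1 Lc N cΛ γ X2s) (hsplit_sym N cΛ γ X2s) hDg hX2L hΔL (hR2succ_sym N cΛ γ X2s) hcomp a ha h12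
    h126 hSL k hμν hNc Jc htel hc hMwin hML hrep

end Summit.QuantumFields.BalabanUV.Beta.RowD1JointEndSymReflTablesAn1S2R

end
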